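import Literature.AlgebraicGeometry.HodgeTheory.AlgebraicClassesHodgeTypeHolds
import Literature.AlgebraicGeometry.HodgeTheory.AlgebraicClassesPullbackHolds
import Literature.AlgebraicGeometry.HodgeTheory.AlgebraicCorrespondenceCategory
import Literature.AlgebraicGeometry.HodgeTheory.ComplexOrientationCycleClassFacts
import Literature.AlgebraicGeometry.HodgeTheory.CorrespondenceCupProductIdentities
import Literature.AlgebraicGeometry.HodgeTheory.DominatedByPowersHodgeConjecture
import Literature.AlgebraicGeometry.HodgeTheory.GysinBaseChangeOfKunneth
import Literature.AlgebraicGeometry.HodgeTheory.GysinHodgeClassLiftProofs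
import Literature.AlgebraicGeometry.HodgeTheory.HodgeClassLiftRationalHodgeMaps
import Literature.AlgebraicGeometry.HodgeTheory.HodgeConjectureDescendsAlongSurjections
import Literature.AlgebraicGeometry.HodgeTheory.HodgeTypeConjugation
import Literature.AlgebraicGeometry.HodgeTheory.HodgeTypeExteriorProduct
import Literature.AlgebraicGeometry.HodgeTheory.KunnethCrossProductsSpanProofs
import Literature.AlgebraicGeometry.HodgeTheory.LefschetzStandardUnconditionalDegrees
import Literature.AlgebraicGeometry.HodgeTheory.MotivatedClassesAlgebraic
import Literature.AlgebraicGeometry.HodgeTheory.MotivatedClassesProofs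
import Literature.AlgebraicGeometry.HodgeTheory.MotivatedClassesRationalSpan
import Literature.AlgebraicGeometry.Motives.VarietiesUnitProofs
import Literature.AlgebraicTopology.SingularHomology.CupProductProofs
import Literature.NumberTheory.Transcendental.DeRhamTheoremMultiplicative
import HarnessLib

/-!
# Arapura 2006, Lemma 4.2 (HC clause; "motivated by `X`" in the algebraic form of Lemma 1.1): the named fact
# `HodgeTheory.Arapura2006_hodgeClasses_algebraic_of_isDominatedByPowers` HOLDS

D. Arapura, *Motivation for Hodge cycles*, Adv. Math. 207 (2006), Lemma 4.2: "Suppose that `X` and `Y` are smooth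
projective varieties such that `Y` is motivated by `X`. If `X` and all its powers satisfies one of the conjectures
(`D`, `B`, `HC`, `GHC`) stated above, then the same conjecture holds for `Y` and all its powers."  The tree records the
`HC` clause, with "motivated by `X`" in the algebraic form of Lemma 1.1 (`HodgeTheory.IsDominatedByPowers`: every
`Hᵏ(Y(ℂ); ℂ)` is spanned by the images of algebraic correspondences from the cartesian powers `Xᵉ`), as the named fact
`HodgeTheory.Arapura2006_hodgeClasses_algebraic_of_isDominatedByPowers` (`HodgeTheory/DominatedByPowersHodgeConjecture`,
consumed as `(h42 : …)` by the hyperkähler / moduli-of-sheaves files).  This file PROVES it: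
`Arapura2006_hodgeClasses_algebraic_of_isDominatedByPowers_holds` (exact name, namespace `Literature.AlgebraicGeometry.HodgeTheory`).

Part 1 (the dominated variety itself, Arapura §1/§4; Floccari–Varesco 2024 Rem. 2.2): a rational `(p,p)`-class `c` of
`Y` lies in a finite sum of images of algebraic correspondences `(γᵢ)_* : H^{2dᵢ}(X^{eᵢ}) → H^{2p}(Y)` with `γᵢ` RATIONAL
algebraic (the algebraic classes are the `ℂ`-span of the rational ones) acting through the complex orientations
(`span_rationalAlgebraicCorrRanges_eq_top`, via `AlgebraicCorrespondence.IsAlgebraicCorrespondence.exists_eq_corrAction`);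
each is a morphism of rational Hodge structures up to an INTEGER Tate twist, killing the types it cannot shift
(§1: `isRationalClass_corrAction_complex`, `isOfHodgeType_corrAction_complex`, `corrAction_eq_zero_of_hodgeType_lt`,
`corrAction_mem_algebraicClasses_complex`: pull-back, cup product with a class of type `(c, c)`, Gysin morphism —
Voisin I §7.3.2, Lemma 11.41); polarisable rational Hodge structures being semisimple (Voisin 2025 Prop. 2.11 /
Cor. 2.12, in the integer-twist form `SurjectiveDescent.exists_isRationalClass_isOfHodgeType_eq_sum_int` of
`HodgeTheory/HodgeConjectureDescendsAlongSurjections`), `c = Σᵢ (γᵢ)_* aᵢ` with `aᵢ` rational of type `(dᵢ, dᵢ)`,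
algebraic by the Hodge conjecture for `X^{eᵢ}` (a point for `eᵢ = 0`: `hodgeConjectureFor_of_dim_zero`,
`hodgeConjectureFor_pow_of_succ`), and `(γᵢ)_*` preserves algebraic classes — **`hodgeConjectureFor_of_isDominatedByPowers`**.

Part 2 (the powers, Arapura: "`M_A(X)` is a tensor category, `[Yᵐ] = [Y]^{⊗m}`"; Fulton §16.1 Ex. 16.1.1 / Prop. 16.1.1):
domination by the powers of `X` is stable under products — the EXTERNAL PRODUCT of an algebraic correspondence with an
identity factor, `exists_isAlgebraicCorrespondence_whiskerLeft` (for `T : Hᵃ(A) → Hᵇ(B)` algebraic and any smooth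
projective `C` there is an algebraic `W : H(C ⊗ A) → H(C ⊗ B)` with `W(pr_C^* z ∪ pr_A^* x) = pr_C^* z ∪ pr_B^* T(x)`, namely
`W = c • (C ◁ pr_B)_* ∘ (– ∪ pr_{B⊗A}^* γ) ∘ (C ◁ pr_A)^*` for `T = γ_*`, by the projection formula `complexGysin_cup` and
the Gysin base change for a product square `gysin_baseChange_of_kunneth`), the Künneth spanning of `H*((C ⊗ A)(ℂ))` by
cross products (`Hatcher2002_crossProducts_span_complexBetti_holds`), and the closure of algebraic correspondences under
pull-backs, cup products with algebraic classes, Gysin morphisms and composition (`AlgebraicCorrespondence.IsAlgebraicCorrespondence.comp`):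
`isAlgebraicCorrespondence_source_le`, `map_braiding_hom_cross`, `nonempty_powTensorPowIso` (`Xᶠ ⊗ Xᵉ ≅ X^{f+e}`),
`isDominatedByPowers_unit`, **`isDominatedByPowers_tensor`**, `isDominatedByPowers_pow_succ`; then
**`Arapura2006_hodgeClasses_algebraic_of_isDominatedByPowers_holds`** (first conjunct: Part 1; second: Part 1 for
`Y^{m+1}`, dominated by the powers of `X`).

Theorems only: no definition, no named fact; the hyperkähler / Kummer users' hypothesis `h42` can now be fed `…_holds`.

Provenance: Literature home (namespace `Literature.AlgebraicGeometry.HodgeTheory.Arapura2006`) of §§2–3 of the Summits-side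
`HodgeConjecture/CorCM/Stage4StrictRoadDischarge` (its §1, the integer-twist engine, is already
`HodgeTheory/HodgeConjectureDescendsAlongSurjections` §1 and is imported, not repeated) and of §§1–2 of
`HodgeConjecture/CorCM/Stage4StrictRoadDischargePowers` (their imports are `Literature/`, Mathlib, the Summits twins of
`fulton1998_map_mem_algebraicClasses_holds'` / `Voisin2003_cupProduct_algebraicClasses_holds'` and the correspondence
category now in `HodgeTheory/AlgebraicCorrespondenceCategory`); the `HC_AV` / `HC_K3Powers` corollaries stay Summits-side.
Lane `lit-hodgefound`, seat p20.

## References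
* [Arapura2006] D. Arapura, *Motivation for Hodge cycles*, Adv. Math. 207 (2006) 762–781, §1 Lemma 1.1, §4 Lemma 4.2
  (arXiv:math/0501348, p. 8: "We now come to the main point. Lemma …").
* [Voisin2025] C. Voisin (2025), §2.1, Prop. 2.11, Cor. 2.12 (Hodge-class lift along rational Hodge maps).
* [VoisinHodgeI2002] C. Voisin, *Hodge Theory and Complex Algebraic Geometry I* (2002), §7.1.1, §7.3.2, §11.3, §11.3.3
  Lemma 11.41, Prop. 11.20.
* [VoisinHodgeII2003] C. Voisin, *Hodge Theory and Complex Algebraic Geometry II* (2003), §9.2.4 Prop. 9.20–9.21, (10.7).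
* [FloccariVaresco2024] S. Floccari, M. Varesco (2024), Rem. 2.2.
* [Fulton1998] W. Fulton, *Intersection Theory*, 2nd ed. (1998), §16.1 Ex. 16.1.1, Prop. 16.1.1.
* [FultonYoungTableaux1997] W. Fulton, *Young Tableaux* (1997), App. B §B.1 (1)–(6).
* [HatcherAT2002] A. Hatcher, *Algebraic Topology* (2002), §3.2 Thm. 3.15, Prop. 3.10.
* [Andre1996Motifs] Y. André, *Pour une théorie inconditionnelle des motifs* (1996), §2.1 pp. 14–15, §4.
-/

noncomputable section

namespace Literature.AlgebraicGeometry.HodgeTheory.Arapura2006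

/-! ## Part 1: The Hodge conjecture for a variety dominated by the powers of `X` -/

section Part1

open _root_.CategoryTheory MonoidalCategory CartesianMonoidalCategory
open scoped TensorProduct Manifold ContDiff
open Literature.AlgebraicGeometry Literature.AlgebraicGeometry.Motives Literature.AlgebraicGeometry.HodgeTheory
open Literature.AlgebraicTopology.SingularHomology
open Literature.AlgebraicGeometry.HodgeTheory.SurjectiveDescent (exists_isRationalClass_isOfHodgeType_eq_sum_int)

/-! ## §1 The action of a rational class of type `(c, c)` for the complex orientations is a rational
Hodge-linear map with Tate twist `c − dim`, killing the types it cannot shift -/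

section CorrAction

variable {n N : ℕ} {Y Z : SchemeOver ℂ}

/-- **`γ_*` preserves rational classes** (`γ` rational, complex orientations): pull-back and cup product
preserve rationality, and so do the Gysin morphisms of the complex orientation family
(`isRationalClass_complexGysin_complexOrientationFamily`). [cite: VoisinHodgeI2002, §7.3.2 and §11.3.3 Lemma 11.41] -/
theorem isRationalClass_corrAction_complex (hY : IsSmoothProjective n Y) (hZ : IsSmoothProjective N Z)
    {c a b : ℕ} (hab : a + 2 * c = b + 2 * N) {γ : complexBetti (Y ⊗ Z) (2 * c)}
    (hγ : IsRationalClass γ) {y : complexBetti Z a} (hy : IsRationalClass y) :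
    IsRationalClass (corrAction complexOrientationFamily hY hZ hab γ y) := by
  rw [corrAction_apply]
  exact isRationalClass_complexGysin_complexOrientationFamily (IsSmoothProjective.tensor_holds hY hZ) hY
    (fst Y Z) _ (IsRationalClass.cup rfl (hy.map _) hγ)

/-- **`γ_*` has bidegree `(c − dim Z, c − dim Z)` on Hodge types for `γ` of type `(c, c)`** (pull-back
preserves types, `∪ γ` adds `(c, c)`, `pr_{Y*}` shifts by `−dim Z`). [cite: VoisinHodgeI2002, §7.3.2 and §11.3.3 Lemma 11.41] -/
theorem isOfHodgeType_corrAction_complex (hY : IsSmoothProjective n Y) (hZ : IsSmoothProjective N Z)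
    {c a b : ℕ} (hab : a + 2 * c = b + 2 * N) {γ : complexBetti (Y ⊗ Z) (2 * c)}
    (hγ : IsOfHodgeType (n + N) (Y ⊗ Z) (2 * c) c c γ) {p q p' q' : ℕ} (hp : p' + N = p + c)
    (hq : q' + N = q + c) {y : complexBetti Z a} (hy : IsOfHodgeType N Z a p q y) :
    IsOfHodgeType n Y b p' q' (corrAction complexOrientationFamily hY hZ hab γ y) := by
  have hYZ := IsSmoothProjective.tensor_holds hY hZ
  have hcup : IsOfHodgeType (n + N) (Y ⊗ Z) (a + 2 * c) (p + c) (q + c)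
      (cupProduct (rfl : a + 2 * c = a + 2 * c) (complexBetti.map (snd Y Z) a y) γ) :=
    cupPreservesHodgeType_of_multiplicative_deRham
      (fun E _ _ _ ↦ Literature.NumberTheory.Transcendental.exists_deRhamIsoFamily_holds E) hYZ
      rfl (hy.map_of_isSmoothProjective hYZ hZ (snd Y Z)) hγ
  rw [corrAction_apply]
  exact isOfHodgeType_complexGysin hodgePQ_independent_of_hodgeModel_holds
    (fun _ _ ↦ nonempty_hodgeModel_holds)
    (fun E _ _ _ ↦ Literature.NumberTheory.Transcendental.exists_deRhamIsoFamily_holds E)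
    complexOrientationFamily hYZ hY (fst Y Z) _ (by omega) (by omega) hcup

/-- **`γ_*` kills the Hodge types it cannot shift**: for `γ` of type `(c, c)` and `y` of type `(p, q)` with
`p + c < dim Z` (or `q + c`), `γ_* y = 0` (`complexGysin_eq_zero_of_hodgeType_of_lt` for `pr_Y`). [cite: VoisinHodgeI2002, §7.3.2 (with Lemma 7.30)] -/
theorem corrAction_eq_zero_of_hodgeType_lt (hY : IsSmoothProjective n Y) (hZ : IsSmoothProjective N Z)
    {c a b : ℕ} (hab : a + 2 * c = b + 2 * N) {γ : complexBetti (Y ⊗ Z) (2 * c)}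
    (hγ : IsOfHodgeType (n + N) (Y ⊗ Z) (2 * c) c c γ) {p q : ℕ} (hpq : p + c < N ∨ q + c < N)
    {y : complexBetti Z a} (hy : IsOfHodgeType N Z a p q y) :
    corrAction complexOrientationFamily hY hZ hab γ y = 0 := by
  have hI : hodgePQ_independent_of_hodgeModel := hodgePQ_independent_of_hodgeModel_holds
  have hYZ := IsSmoothProjective.tensor_holds hY hZ
  obtain ⟨B⟩ := nonempty_hodgeModel_holds (n := n + N) (X := Y ⊗ Z) hYZ
  obtain ⟨A⟩ := nonempty_hodgeModel_holds (n := n) (X := Y) hY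
  have hcup : IsOfHodgeType (n + N) (Y ⊗ Z) (a + 2 * c) (p + c) (q + c)
      (cupProduct (rfl : a + 2 * c = a + 2 * c) (complexBetti.map (snd Y Z) a y) γ) :=
    cupPreservesHodgeType_of_multiplicative_deRham
      (fun E _ _ _ ↦ Literature.NumberTheory.Transcendental.exists_deRhamIsoFamily_holds E) hYZ
      rfl (hy.map_of_isSmoothProjective hYZ hZ (snd Y Z)) hγ
  rw [corrAction_apply]
  exact complexGysin_eq_zero_of_hodgeType_of_lt hI complexOrientationFamily hYZ hY B A
    (cupPreservesHodgeType_of_multiplicative_deRham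
      (fun E _ _ _ ↦ Literature.NumberTheory.Transcendental.exists_deRhamIsoFamily_holds E) hYZ)
    (cupPreservesHodgeType_of_multiplicative_deRham
      (fun E _ _ _ ↦ Literature.NumberTheory.Transcendental.exists_deRhamIsoFamily_holds E) hY)
    (fst Y Z) _ (by omega) ((isOfHodgeType_iff_mem_hodgePQ hYZ B _).1 hcup)

/-- **`γ_*` carries algebraic classes to algebraic classes** for `γ` algebraic and the complex orientations
(flat pull-back, the PROVED multiplicativity `Voisin2003_cupProduct_algebraicClasses_holds'`, proper
push-forward: the tree's `corrClassAction_mem_algebraicClasses_of_cupProduct`), in degrees `2p' ≤ 2 dim Y`.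
[cite: VoisinHodgeII2003, §9.2.4 Prop. 9.20 and Prop. 9.21] -/
theorem corrAction_mem_algebraicClasses_complex (hY : IsSmoothProjective n Y) (hZ : IsSmoothProjective N Z)
    {c d p' k : ℕ} (hab : 2 * d + 2 * c = 2 * p' + 2 * N) (hk : 2 * p' + k = 2 * n)
    {γ : complexBetti (Y ⊗ Z) (2 * c)} (hγ : γ ∈ algebraicClasses (Y ⊗ Z) c)
    {z : complexBetti Z (2 * d)} (hz : z ∈ algebraicClasses Z d) :
    corrAction complexOrientationFamily hY hZ hab γ z ∈ algebraicClasses Y p' := by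
  have hYZ := IsSmoothProjective.tensor_holds hY hZ
  rw [corrAction_eq_corrClassAction complexOrientationFamily hY hZ hab hk]
  exact corrClassAction_mem_algebraicClasses_of_cupProduct hY hZ _ _
    (complexOrientationFamily.hasPoincareDuality hY) hab hk
    (fun _ _ hx hy ↦ Voisin2003_cupProduct_algebraicClasses_holds' hYZ hx hy) hγ hz

end CorrAction

/-! ## §2 The Hodge conjecture for a variety dominated by the powers of `X` -/

section Dominated

variable {dX dY : ℕ} {X Y : SchemeOver ℂ}

/-- **The Hodge conjecture in dimension `0`** (the point `X⁰ = Spec ℂ`): a Hodge model exists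
(`nonempty_hodgeModel_holds`), `N⁰ H⁰ = H⁰`, and `H^{2d} = 0` for `d ≥ 1`. [cite: VoisinHodgeI2002, §11.3] -/
theorem hodgeConjectureFor_of_dim_zero {P : SchemeOver ℂ} (hP : IsSmoothProjective 0 P) :
    HodgeConjectureFor 0 P := by
  refine ⟨nonempty_hodgeModel_holds hP, fun d z _ _ ↦ ?_⟩
  cases d with
  | zero => exact hodgeConjectureFor_codim_zero z
  | succ d =>
    haveI := subsingleton_complexBetti hP (k := 2 * (d + 1)) (by omega)
    rw [Subsingleton.elim z 0]
    exact Submodule.zero_mem _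

/-- The Hodge conjecture for ALL cartesian powers `Xᵉ`, `e ≥ 0`, from the positive ones (the power `X⁰`
is a point). [cite: Arapura2006, Lemma 4.2] -/
theorem hodgeConjectureFor_pow_of_succ (hX : IsSmoothProjective dX X)
    (hpow : ∀ m : ℕ, HodgeConjectureFor ((m + 1) * dX) (X.pow (m + 1))) :
    ∀ e : ℕ, HodgeConjectureFor (e * dX) (X.pow e)
  | 0 => by
    have h0 : IsSmoothProjective (0 * dX) (X.pow 0) := hX.pow 0
    rw [Nat.zero_mul] at h0 ⊢
    exact hodgeConjectureFor_of_dim_zero h0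
  | e + 1 => hpow e

/-- **Domination may be witnessed by RATIONAL algebraic classes acting through the COMPLEX orientations**:
`H^{2p}(Y(ℂ); ℂ)` is the `ℂ`-span of the images of the `γ_* = corrAction complexOrientationFamily …`, `γ` rational
algebraic on `Y ⊗ Xᵉ` (every algebraic correspondence is such a `γ_*` with `γ` algebraic,
`AlgebraicCorrespondence.IsAlgebraicCorrespondence.exists_eq_corrAction`; algebraic classes are spanned by the rational ones,
`algebraicClasses_le_span_isRationalClass`; `γ ↦ γ_* x` is linear). [cite: Arapura2006, §1 Lemma 1.1] -/
theorem span_rationalAlgebraicCorrRanges_eq_top (hX : IsSmoothProjective dX X) (hY : IsSmoothProjective dY Y)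
    (hdom : IsDominatedByPowers dY Y dX X) (p : ℕ) :
    Submodule.span ℂ
        {c : complexBetti Y (2 * p) |
          ∃ (e cd d : ℕ) (hab : 2 * d + 2 * cd = 2 * p + 2 * (e * dX))
            (γ : complexBetti (Y ⊗ X.pow e) (2 * cd)),
            IsRationalClass γ ∧ γ ∈ algebraicClasses (Y ⊗ X.pow e) cd ∧
              c ∈ LinearMap.range (corrAction complexOrientationFamily hY (hX.pow e) hab γ)} = ⊤ := by
  refine eq_top_iff.2 ((hdom (2 * p)).symm.le.trans (Submodule.span_le.2 ?_))
  rintro c ⟨e, a, T, hT, ⟨x, rfl⟩⟩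
  obtain ⟨cd, hab, γ, hγ, rfl⟩ :=
    Literature.AlgebraicGeometry.HodgeTheory.AlgebraicCorrespondence.IsAlgebraicCorrespondence.exists_eq_corrAction
      hY (hX.pow e) hT
  obtain ⟨d, rfl⟩ : ∃ d, a = 2 * d := ⟨a / 2, by omega⟩
  have hYXe := IsSmoothProjective.tensor_holds hY (hX.pow e)
  -- `γ ↦ γ_* x` is linear and `γ` is a `ℂ`-combination of rational algebraic classes
  have hγ' := algebraicClasses_le_span_isRationalClass hYXe cd hγ
  have hlin : corrAction complexOrientationFamily hY (hX.pow e) hab γ x =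
      ((corrAction complexOrientationFamily hY (hX.pow e) hab).flip x) γ := by
    rw [LinearMap.flip_apply]
  rw [SetLike.mem_coe, hlin]
  have hmem : ((corrAction complexOrientationFamily hY (hX.pow e) hab).flip x) γ ∈
      (Submodule.span ℂ {g : complexBetti (Y ⊗ X.pow e) (2 * cd) |
          IsRationalClass g ∧ g ∈ algebraicClasses (Y ⊗ X.pow e) cd}).map
        ((corrAction complexOrientationFamily hY (hX.pow e) hab).flip x) :=
    Submodule.mem_map_of_mem hγ'
  rw [Submodule.map_span] at hmem
  refine Submodule.span_mono ?_ hmem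
  rintro _ ⟨g, ⟨hg₁, hg₂⟩, rfl⟩
  exact ⟨e, cd, d, hab, g, hg₁, hg₂, x, by rw [LinearMap.flip_apply]⟩

/-- **Arapura 2006, Lemma 4.2 (HC clause, algebraic form) for the dominated variety itself — PROVED**: for
`X`, `Y` smooth projective over `ℂ` with `IsDominatedByPowers dY Y dX X`, the Hodge conjecture for all positive
cartesian powers `X^{m+1}` implies the Hodge conjecture for `Y` — the first conjunct of the named fact
`HodgeTheory.Arapura2006_hodgeClasses_algebraic_of_isDominatedByPowers`, no hypothesis left (module docstring:
finitely many rational algebraic `(γᵢ)_*` carry the class; the integer-twist Hodge-class lift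
`SurjectiveDescent.exists_isRationalClass_isOfHodgeType_eq_sum_int` with twists `dᵢ + cdᵢ − eᵢ·dX = p` writes it as
`Σᵢ (γᵢ)_* aᵢ`, `aᵢ` rational of type `(dᵢ, dᵢ)`, algebraic by HC for `X^{eᵢ}` (a point for `eᵢ = 0`), and
`(γᵢ)_*` preserves algebraic classes). [cite: Arapura2006, Lemma 4.2 and Lemma 1.1 (§4, §1)]
[cite: Voisin2025, Cor. 2.12] [cite: FloccariVaresco2024, Rem. 2.2] -/
theorem hodgeConjectureFor_of_isDominatedByPowers (hX : IsSmoothProjective dX X)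
    (hY : IsSmoothProjective dY Y) (hdom : IsDominatedByPowers dY Y dX X)
    (hpow : ∀ m : ℕ, HodgeConjectureFor ((m + 1) * dX) (X.pow (m + 1))) :
    HodgeConjectureFor dY Y := by
  classical
  refine ⟨nonempty_hodgeModel_holds hY, fun p c hc hpp ↦ ?_⟩
  -- degrees beyond `2 dim Y`: nothing to prove
  by_cases hp : 2 * dY < 2 * p
  · haveI := subsingleton_complexBetti hY hp
    rw [Subsingleton.elim c 0]
    exact Submodule.zero_mem _
  obtain ⟨k, hk⟩ : ∃ k, 2 * p + k = 2 * dY := ⟨2 * dY - 2 * p, by omega⟩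
  have hpow' := hodgeConjectureFor_pow_of_succ hX hpow
  -- a finite family of rational algebraic correspondences carrying `c`
  have hc1 := (span_rationalAlgebraicCorrRanges_eq_top hX hY hdom p).symm ▸ Submodule.mem_top (x := c)
  obtain ⟨T, hTS, hcT⟩ := Submodule.mem_span_finite_of_mem_span hc1
  have hdata : ∀ t : T, ∃ (e cd d : ℕ) (hab : 2 * d + 2 * cd = 2 * p + 2 * (e * dX))
      (γ : complexBetti (Y ⊗ X.pow e) (2 * cd)),
      IsRationalClass γ ∧ γ ∈ algebraicClasses (Y ⊗ X.pow e) cd ∧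
        (t : complexBetti Y (2 * p)) ∈
          LinearMap.range (corrAction complexOrientationFamily hY (hX.pow e) hab γ) :=
    fun t ↦ hTS t.2
  choose e cd d hab γ hγr hγa hγt using hdata
  -- the integer-twist Hodge-class lift (`SurjectiveDescent`) for the family `(γ t)_*`, twists `cd t − e t · dX`
  obtain ⟨a, ha, hsum⟩ := exists_isRationalClass_isOfHodgeType_eq_sum_int hY
    (ι := T) (m := fun t ↦ e t * dX) (d := d) (Y := fun t ↦ X.pow (e t)) (fun t ↦ hX.pow (e t)) p
    (fun t ↦ (cd t : ℤ) - (e t * dX : ℕ)) (fun t ↦ by have := hab t; push_cast; omega)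
    (fun t ↦ corrAction complexOrientationFamily hY (hX.pow (e t)) (hab t) (γ t))
    (fun t y hy ↦ isRationalClass_corrAction_complex hY (hX.pow (e t)) (hab t) (hγr t) hy)
    (fun t p₀ q₀ y _ hy p₁ q₁ hp₁ hq₁ ↦ isOfHodgeType_corrAction_complex hY (hX.pow (e t)) (hab t)
      (isOfHodgeType_of_mem_algebraicClasses_of_isSmoothProjective
        (IsSmoothProjective.tensor_holds hY (hX.pow (e t))) (cd t) (hγa t))
      (by push_cast at hp₁; omega) (by push_cast at hq₁; omega) hy)
    (fun t p₀ q₀ y _ hy hlt ↦ corrAction_eq_zero_of_hodgeType_lt hY (hX.pow (e t)) (hab t)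
      (isOfHodgeType_of_mem_algebraicClasses_of_isSmoothProjective
        (IsSmoothProjective.tensor_holds hY (hX.pow (e t))) (cd t) (hγa t))
      (by push_cast at hlt; omega) hy)
    hc hpp (Submodule.span_le.2 (fun t ht ↦ Submodule.mem_iSup_of_mem (⟨t, ht⟩ : T) (hγt ⟨t, ht⟩)) hcT)
  -- each summand is algebraic
  rw [hsum]
  refine Submodule.sum_mem _ fun t _ ↦ ?_
  exact corrAction_mem_algebraicClasses_complex hY (hX.pow (e t)) (hab t) hk (hγa t)
    ((hpow' (e t)).2 (d t) (a t) (ha t).1 (ha t).2)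

end Dominated

end Part1

/-! ## Part 2: Products and powers of dominated varieties; the named fact -/

section Part2

open _root_.CategoryTheory MonoidalCategory CartesianMonoidalCategory
open Literature.AlgebraicGeometry Literature.AlgebraicGeometry.Motives Literature.AlgebraicGeometry.HodgeTheory
open Literature.AlgebraicTopology.SingularHomology
open Literature.AlgebraicGeometry.HodgeTheory.AlgebraicCorrespondence (IsAlgebraicCorrespondence.exists_eq_corrAction
  IsAlgebraicCorrespondence.comp IsAlgebraicCorrespondence.smul IsAlgebraicCorrespondence.le_two_mul)

/-! ## §1 The external product of an algebraic correspondence with an identity factor -/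

section Whisker

variable {l m n : ℕ} {C B A : SchemeOver ℂ}

/-- **External product with an identity factor** (Fulton Ex. 16.1.1 / Prop. 16.1.1 on the real carriers): for
`C, B, A` smooth projective, `T : Hᵃ(A(ℂ)) → Hᵇ(B(ℂ))` induced by an algebraic correspondence and degrees
`j + a = k`, `j + b = k' ≤ 2 dim (C ⊗ B)`, there is a linear map `W : Hᵏ((C ⊗ A)(ℂ)) → H^{k'}((C ⊗ B)(ℂ))`
induced by an algebraic correspondence with `W (pr_C^* z ∪ pr_A^* x) = pr_C^* z ∪ pr_B^* (T x)` for all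
`z ∈ Hʲ(C(ℂ))`, `x ∈ Hᵃ(A(ℂ))`.  Proof: `T = γ_*` for the complex orientations (`exists_eq_corrAction`); on
`C ⊗ (B ⊗ A)` put `W₀ = (C ◁ pr_B)_* ∘ (– ∪ pr_{B⊗A}^* γ) ∘ (C ◁ pr_A)^*`, a composite of three algebraic
correspondences; `(C ◁ pr_A)^*(pr_C^* z ∪ pr_A^* x) ∪ pr_{B⊗A}^* γ = pr_C^* z ∪ pr_{B⊗A}^*(pr_A^* x ∪ γ)`
(functoriality, multiplicativity and associativity), the projection formula gives
`W₀(…) = pr_C^* z ∪ (C ◁ pr_B)_* pr_{B⊗A}^* v`, and the product base change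
`pr_{B}^*∘(pr_B)_* = c • (C ◁ pr_B)_* ∘ pr_{B⊗A}^*` (read on `C ⊗ B`) identifies `c • W₀` with the required map.
[cite: Fulton1998, §16.1 Ex. 16.1.1 and Prop. 16.1.1] [cite: FultonYoungTableaux1997, Appendix B §B.1 (1), (5), (6)]
[cite: VoisinHodgeII2003, proof of Thm. 10.17 (10.7)] -/
theorem exists_isAlgebraicCorrespondence_whiskerLeft (hC : IsSmoothProjective l C)
    (hB : IsSmoothProjective m B) (hA : IsSmoothProjective n A) {a b : ℕ}
    {T : complexBetti A a →ₗ[ℂ] complexBetti B b} (hT : IsAlgebraicCorrespondence m n B A T)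
    {j k k' : ℕ} (hk : j + a = k) (hk' : j + b = k') (hdeg : k' ≤ 2 * (l + m)) :
    ∃ W : complexBetti (C ⊗ A) k →ₗ[ℂ] complexBetti (C ⊗ B) k',
      IsAlgebraicCorrespondence (l + m) (l + n) (C ⊗ B) (C ⊗ A) W ∧
        ∀ (z : complexBetti C j) (x : complexBetti A a),
          W (cupProduct hk (complexBetti.map (fst C A) j z) (complexBetti.map (snd C A) a x)) =
            cupProduct hk' (complexBetti.map (fst C B) j z) (complexBetti.map (snd C B) b (T x)) := by
  obtain ⟨e, hab, γ, hγ, rfl⟩ := IsAlgebraicCorrespondence.exists_eq_corrAction hB hA hT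
  have hBA := IsSmoothProjective.tensor_holds hB hA
  have hP := IsSmoothProjective.tensor_holds hC hBA
  have hCA := IsSmoothProjective.tensor_holds hC hA
  have hCB := IsSmoothProjective.tensor_holds hC hB
  -- the algebraic class `pr_{B⊗A}^* γ` on `C ⊗ (B ⊗ A)` and the three maps
  set γP : complexBetti (C ⊗ (B ⊗ A)) (2 * e) := complexBetti.map (snd C (B ⊗ A)) (2 * e) γ with hγP
  have hγPa : γP ∈ algebraicClasses (C ⊗ (B ⊗ A)) e :=
    fulton1998_map_mem_algebraicClasses_holds' (snd C (B ⊗ A)) hBA hP e γ hγ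
  have hke : k + 2 * e + 2 * (l + m) = k' + 2 * (l + (m + n)) := by omega
  set Pb : complexBetti (C ⊗ A) k →ₗ[ℂ] complexBetti (C ⊗ (B ⊗ A)) k :=
    (complexBetti.map (C ◁ snd B A) k).hom with hPb
  set Cu : complexBetti (C ⊗ (B ⊗ A)) k →ₗ[ℂ] complexBetti (C ⊗ (B ⊗ A)) (k + 2 * e) :=
    (cupProduct (rfl : k + 2 * e = k + 2 * e)).flip γP with hCu
  set Gy : complexBetti (C ⊗ (B ⊗ A)) (k + 2 * e) →ₗ[ℂ] complexBetti (C ⊗ B) k' :=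
    complexGysin complexOrientationFamily hP hCB (C ◁ fst B A) hke with hGy
  -- the product base change, read on `C ⊗ B`
  obtain ⟨c, hc⟩ := gysin_baseChange_of_kunneth complexOrientationFamily hC hB hA
    Hatcher2002_crossProducts_span_complexBetti_holds (k := a + 2 * e) (k₁ := b)
    (show a + 2 * e + 2 * m = b + 2 * (m + n) by omega)
  refine ⟨c • (Gy ∘ₗ Cu ∘ₗ Pb), ?_, fun z x ↦ ?_⟩
  · -- a composite of algebraic correspondences
    refine IsAlgebraicCorrespondence.smul hCB hCA ?_ c
    have h1 : IsAlgebraicCorrespondence (l + (m + n)) (l + n) (C ⊗ (B ⊗ A)) (C ⊗ A) Pb :=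
      isAlgebraicCorrespondence_map hP hCA (C ◁ snd B A) (by omega)
    have h2 : IsAlgebraicCorrespondence (l + (m + n)) (l + (m + n)) (C ⊗ (B ⊗ A)) (C ⊗ (B ⊗ A)) Cu :=
      isAlgebraicCorrespondence_flip_cupProduct_of_mem_algebraicClasses hP rfl (by omega) hγPa
    have h3 : IsAlgebraicCorrespondence (l + m) (l + (m + n)) (C ⊗ B) (C ⊗ (B ⊗ A)) Gy :=
      isAlgebraicCorrespondence_complexGysin complexOrientationFamily
        (OrientationFamily.hasPoincareDuality _) hP hCB (C ◁ fst B A) hke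
        (show k' + (2 * (l + m) - k') = 2 * (l + m) by omega)
    exact IsAlgebraicCorrespondence.comp hCB hP hCA (IsAlgebraicCorrespondence.comp hP hP hCA h1 h2 (by omega))
      h3 (by omega)
  · -- the value on a cross product
    have hjs : j + (a + 2 * e) = k + 2 * e := by omega
    have hq : a + 2 * e + 2 * (l + m) = b + 2 * (l + (m + n)) := by omega
    rw [LinearMap.smul_apply, LinearMap.comp_apply, LinearMap.comp_apply]
    -- (1) pull-back along `C ◁ pr_A`: `pr_C^* z ∪ pr_{B⊗A}^* pr_A^* x`
    have h1 : Pb (cupProduct hk (complexBetti.map (fst C A) j z) (complexBetti.map (snd C A) a x)) =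
        cupProduct hk (complexBetti.map (fst C (B ⊗ A)) j z)
          (complexBetti.map (snd C (B ⊗ A)) a (complexBetti.map (snd B A) a x)) := by
      rw [hPb]
      change complexBetti.map (C ◁ snd B A) k _ = _
      rw [complexBetti.map_cupProduct, ← complexBetti.map_comp_apply', ← complexBetti.map_comp_apply',
        whiskerLeft_fst, whiskerLeft_snd, complexBetti.map_comp_apply']
    -- (2) cup product with `pr_{B⊗A}^* γ`: `pr_C^* z ∪ pr_{B⊗A}^* (pr_A^* x ∪ γ)`
    have h2 : Cu (cupProduct hk (complexBetti.map (fst C (B ⊗ A)) j z)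
          (complexBetti.map (snd C (B ⊗ A)) a (complexBetti.map (snd B A) a x))) =
        cupProduct hjs (complexBetti.map (fst C (B ⊗ A)) j z)
          (complexBetti.map (snd C (B ⊗ A)) (a + 2 * e)
            (cupProduct (rfl : a + 2 * e = a + 2 * e) (complexBetti.map (snd B A) a x) γ)) := by
      rw [hCu, LinearMap.flip_apply, hγP, cupProduct_assoc hk rfl rfl hjs, complexBetti.map_cupProduct]
    -- (3) projection formula for `C ◁ pr_B`
    have h3 : Gy (cupProduct hjs (complexBetti.map (fst C (B ⊗ A)) j z)
          (complexBetti.map (snd C (B ⊗ A)) (a + 2 * e)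
            (cupProduct (rfl : a + 2 * e = a + 2 * e) (complexBetti.map (snd B A) a x) γ))) =
        cupProduct hk' (complexBetti.map (fst C B) j z)
          (complexGysin complexOrientationFamily hP hCB (C ◁ fst B A) hq
            (complexBetti.map (snd C (B ⊗ A)) (a + 2 * e)
              (cupProduct (rfl : a + 2 * e = a + 2 * e) (complexBetti.map (snd B A) a x) γ))) := by
      rw [hGy, ← whiskerLeft_fst C (fst B A), complexBetti.map_comp_apply']
      exact complexGysin_cup (OrientationFamily.hasPoincareDuality _) hP hCB (C ◁ fst B A) hjs hke hq
        hk' _ _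
    rw [h1, h2, h3, corrAction_apply, hc, map_smul]

end Whisker

/-! ## §2 Domination by the powers of `X` is stable under products; powers of a dominated variety; the named fact -/

section Products

variable {dX l n : ℕ} {X C A : SchemeOver ℂ}

/-- The source degree of an algebraic correspondence `Hᵃ(X) → Hᵇ(W)` satisfies `a ≤ b + 2 dim X`
(`a + 2e = b + 2 dim X` for the codimension `e` of the class). [cite: Andre1996Motifs, §2.1 (p. 14)] -/
theorem isAlgebraicCorrespondence_source_le {m' n' : ℕ} {W X' : SchemeOver ℂ} {a b : ℕ}
    {T : complexBetti X' a →ₗ[ℂ] complexBetti W b} (h : IsAlgebraicCorrespondence m' n' W X' T) :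
    a ≤ b + 2 * n' := by
  obtain ⟨_, _, _, _, _, _, hab, _, _⟩ := h
  omega

/-- **Pull-back along the braiding on a cross product**: `(β_{U,V})^*(pr_V^* y ∪ pr_U^* x) = (−1)^{qp} · (pr_U^* x ∪ pr_V^* y)`
(`β ≫ pr_V = pr_V`, `β ≫ pr_U = pr_U` on `U ⊗ V → V ⊗ U`; graded commutativity, Hatcher Thm. 3.11).
[cite: HatcherAT2002, §3.2 Prop. 3.10 and Thm. 3.11] -/
theorem map_braiding_hom_cross {U V : SchemeOver ℂ} {p q s : ℕ} (h : q + p = s) (h' : p + q = s)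
    (x : complexBetti U p) (y : complexBetti V q) :
    complexBetti.map (β_ U V).hom s
        (cupProduct h (complexBetti.map (fst V U) q y) (complexBetti.map (snd V U) p x)) =
      ((-1 : ℂ) ^ (q * p)) •
        cupProduct h' (complexBetti.map (fst U V) p x) (complexBetti.map (snd U V) q y) := by
  rw [complexBetti.map_cupProduct, ← complexBetti.map_comp_apply', ← complexBetti.map_comp_apply',
    braiding_hom_fst, braiding_hom_snd]
  exact cupProduct_gradedComm_holds ℂ (Motives.ComplexPoints (U ⊗ V)) h h' _ _

/-- `Xᶠ ⊗ Xᵉ ≅ X^{f+e}` (re-bracketing the iterated product `X^{m+1} = Xᵐ ⊗ X`: right unitor and associators).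
 [cite: Arapura2006, §1 Lemma 1.1 and §4 Lemma 4.2] -/
theorem nonempty_powTensorPowIso (X : SchemeOver ℂ) (f : ℕ) :
    ∀ e : ℕ, Nonempty (X.pow f ⊗ X.pow e ≅ X.pow (f + e))
  | 0 => ⟨ρ_ (X.pow f)⟩
  | e + 1 => (nonempty_powTensorPowIso X f e).elim fun i ↦
      ⟨(α_ (X.pow f) (X.pow e) X).symm ≪≫ whiskerRightIso i X⟩

/-- **The point `Spec ℂ` is dominated by the powers of any `X`**: `H⁰` is reached by the identity correspondence
from `X⁰ = Spec ℂ` (the graph of `𝟙`, `isAlgebraicCorrespondence_map`), and `Hᵏ = 0` for `k > 0`.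
[cite: Arapura2006, §1 Lemma 1.1] -/
theorem isDominatedByPowers_unit (hX : IsSmoothProjective dX X) :
    IsDominatedByPowers 0 (𝟙_ (SchemeOver ℂ)) dX X := by
  intro k
  refine eq_top_iff.2 fun c _ ↦ ?_
  rcases Nat.eq_zero_or_pos k with rfl | hk
  · have h0 : IsSmoothProjective (0 * dX) (X.pow 0) := hX.pow 0
    have hT : IsAlgebraicCorrespondence 0 (0 * dX) (𝟙_ (SchemeOver ℂ)) (X.pow 0)
        (complexBetti.map (𝟙 (X.pow 0)) 0).hom :=
      isAlgebraicCorrespondence_map (isSmoothProjective_unit_holds ℂ) h0 (𝟙 (X.pow 0)) le_rfl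
    refine Submodule.subset_span ⟨0, 0, (complexBetti.map (𝟙 (X.pow 0)) 0).hom, hT, c, ?_⟩
    change complexBetti.map (𝟙 (X.pow 0)) 0 c = c
    rw [complexBetti.map_id]
    rfl
  · haveI := subsingleton_complexBetti (isSmoothProjective_unit_holds ℂ) (k := k) (by omega)
    rw [Subsingleton.elim c 0]
    exact Submodule.zero_mem _

/-- **Products of dominated varieties are dominated** (Arapura 2006 §1/§4: `M_A(X)` is a tensor category; on
the real carriers): if `C` (dimension `l`) and `A` (dimension `n`) are dominated by the powers of `X`, so is
`C ⊗ A`.  Proof: `Hᵏ((C ⊗ A)(ℂ))` is spanned by cross products `pr_C^* z ∪ pr_A^* x` (Künneth,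
`Hatcher2002_crossProducts_span_complexBetti_holds`), bilinear in `(z, x)`, so it suffices to treat `z = T z₀`,
`x = S x₀` for algebraic correspondences `T`, `S` from `X^{e₁}`, `X^{e₂}`; then
`pr_C^* (T z₀) ∪ pr_A^* (S x₀) = ± (W₁ ∘ β^* ∘ W₂ ∘ φ^*)(y)` for the external products `W₁ = C ⊗ S`,
`W₂ = X^{e₂} ⊗ T` of §1, the braiding `β : C ⊗ X^{e₂} ≅ X^{e₂} ⊗ C`, the re-bracketing
`φ : X^{e₂} ⊗ X^{e₁} ≅ X^{e₂+e₁}` and `y = (φ⁻¹)^*(pr^* x₀ ∪ pr^* z₀)` — a composite of algebraic correspondences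
(`IsAlgebraicCorrespondence.comp`, `isAlgebraicCorrespondence_map`). [cite: Arapura2006, §1 Lemma 1.1 and §4 Lemma 4.2]
[cite: Fulton1998, §16.1 Prop. 16.1.1] [cite: HatcherAT2002, §3.2 Thm. 3.15] -/
theorem isDominatedByPowers_tensor (hX : IsSmoothProjective dX X) (hC : IsSmoothProjective l C)
    (hA : IsSmoothProjective n A) (hdC : IsDominatedByPowers l C dX X) (hdA : IsDominatedByPowers n A dX X) :
    IsDominatedByPowers (l + n) (C ⊗ A) dX X := by
  classical
  intro k
  have hCA := IsSmoothProjective.tensor_holds hC hA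
  refine eq_top_iff.2 fun w _ ↦ ?_
  refine Submodule.span_le.2 ?_ (Hatcher2002_crossProducts_span_complexBetti_holds hC hA k w)
  rintro _ ⟨i, j, hij, z, x, rfl⟩
  rw [SetLike.mem_coe]
  -- the cross product is bilinear: reduce to generators of the two dominations
  set Φ : complexBetti C i →ₗ[ℂ] complexBetti A j →ₗ[ℂ] complexBetti (C ⊗ A) k :=
    (cupProduct hij).compl₁₂ (complexBetti.map (fst C A) i).hom (complexBetti.map (snd C A) j).hom with hΦ
  have hz : z ∈ Submodule.span ℂ {c : complexBetti C i | ∃ (e a : ℕ)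
      (T : complexBetti (X.pow e) a →ₗ[ℂ] complexBetti C i),
      IsAlgebraicCorrespondence l (e * dX) C (X.pow e) T ∧ c ∈ LinearMap.range T} := by
    rw [hdC i]; exact Submodule.mem_top
  have hx : x ∈ Submodule.span ℂ {c : complexBetti A j | ∃ (e a : ℕ)
      (T : complexBetti (X.pow e) a →ₗ[ℂ] complexBetti A j),
      IsAlgebraicCorrespondence n (e * dX) A (X.pow e) T ∧ c ∈ LinearMap.range T} := by
    rw [hdA j]; exact Submodule.mem_top
  have hzx := Submodule.apply_mem_map₂ Φ hz hx
  rw [Submodule.map₂_span_span] at hzx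
  change Φ z x ∈ _
  refine Submodule.span_le.2 ?_ hzx
  rintro _ ⟨_, ⟨e₁, a₁, T, hT, z₀, rfl⟩, _, ⟨e₂, a₂, S, hS, x₀, rfl⟩, rfl⟩
  rw [SetLike.mem_coe]
  change cupProduct hij (complexBetti.map (fst C A) i (T z₀)) (complexBetti.map (snd C A) j (S x₀)) ∈ _
  -- degrees
  have hi : i ≤ 2 * l := IsAlgebraicCorrespondence.le_two_mul hT
  have hj : j ≤ 2 * n := IsAlgebraicCorrespondence.le_two_mul hS
  have ha₁i : a₁ ≤ i + 2 * (e₁ * dX) := isAlgebraicCorrespondence_source_le hT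
  have ha₂j : a₂ ≤ j + 2 * (e₂ * dX) := isAlgebraicCorrespondence_source_le hS
  have hde : (e₂ + e₁) * dX = e₂ * dX + e₁ * dX := Nat.add_mul e₂ e₁ dX
  by_cases ha₁ : a₁ ≤ 2 * (e₁ * dX); swap
  · haveI := subsingleton_complexBetti (hX.pow e₁) (not_le.1 ha₁)
    rw [Subsingleton.elim z₀ 0, map_zero, map_zero, map_zero, LinearMap.zero_apply]
    exact Submodule.zero_mem _
  by_cases ha₂ : a₂ ≤ 2 * (e₂ * dX); swap
  · haveI := subsingleton_complexBetti (hX.pow e₂) (not_le.1 ha₂)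
    rw [Subsingleton.elim x₀ 0, map_zero, map_zero, map_zero]
    exact Submodule.zero_mem _
  -- the external products `W₁ = C ⊗ S : H(C ⊗ X^{e₂}) → H(C ⊗ A)`, `W₂ = X^{e₂} ⊗ T : H(X^{e₂} ⊗ X^{e₁}) → H(X^{e₂} ⊗ C)`
  obtain ⟨W₁, hW₁, hW₁v⟩ := exists_isAlgebraicCorrespondence_whiskerLeft hC hA (hX.pow e₂) hS
    (j := i) (k := a₂ + i) (k' := k) (by omega) hij (by omega)
  obtain ⟨W₂, hW₂, hW₂v⟩ := exists_isAlgebraicCorrespondence_whiskerLeft (hX.pow e₂) hC (hX.pow e₁) hT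
    (j := a₂) (k := a₂ + a₁) (k' := a₂ + i) rfl rfl (by omega)
  obtain ⟨φ⟩ := nonempty_powTensorPowIso X e₂ e₁
  have hXX := IsSmoothProjective.tensor_holds (hX.pow e₂) (hX.pow e₁)
  have hXC := IsSmoothProjective.tensor_holds (hX.pow e₂) hC
  have hCX := IsSmoothProjective.tensor_holds hC (hX.pow e₂)
  have hσ : IsAlgebraicCorrespondence (l + e₂ * dX) (e₂ * dX + l) (C ⊗ X.pow e₂) (X.pow e₂ ⊗ C)
      (complexBetti.map (β_ C (X.pow e₂)).hom (a₂ + i)).hom :=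
    isAlgebraicCorrespondence_map hCX hXC (β_ C (X.pow e₂)).hom (by omega)
  have hφ : IsAlgebraicCorrespondence (e₂ * dX + e₁ * dX) ((e₂ + e₁) * dX) (X.pow e₂ ⊗ X.pow e₁)
      (X.pow (e₂ + e₁)) (complexBetti.map φ.hom (a₂ + a₁)).hom :=
    isAlgebraicCorrespondence_map hXX (hX.pow (e₂ + e₁)) φ.hom (by omega)
  set R : complexBetti (X.pow (e₂ + e₁)) (a₂ + a₁) →ₗ[ℂ] complexBetti (C ⊗ A) k :=
    W₁ ∘ₗ (complexBetti.map (β_ C (X.pow e₂)).hom (a₂ + i)).hom ∘ₗ W₂ ∘ₗ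
      (complexBetti.map φ.hom (a₂ + a₁)).hom with hR
  have hRalg : IsAlgebraicCorrespondence (l + n) ((e₂ + e₁) * dX) (C ⊗ A) (X.pow (e₂ + e₁)) R := by
    refine IsAlgebraicCorrespondence.comp hCA hCX (hX.pow _) ?_ hW₁ (by omega)
    refine IsAlgebraicCorrespondence.comp hCX hXC (hX.pow _) ?_ hσ (by omega)
    exact IsAlgebraicCorrespondence.comp hXC hXX (hX.pow _) hφ hW₂ (by omega)
  -- the value: `R ((φ⁻¹)^* (pr^* x₀ ∪ pr^* z₀)) = (−1)^{a₂ i} · (pr_C^* T z₀ ∪ pr_A^* S x₀)`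
  set y₀ : complexBetti (X.pow e₂ ⊗ X.pow e₁) (a₂ + a₁) :=
    cupProduct (rfl : a₂ + a₁ = a₂ + a₁) (complexBetti.map (fst (X.pow e₂) (X.pow e₁)) a₂ x₀)
      (complexBetti.map (snd (X.pow e₂) (X.pow e₁)) a₁ z₀) with hy₀
  have hRy : R (complexBetti.map φ.inv (a₂ + a₁) y₀) =
      ((-1 : ℂ) ^ (a₂ * i)) •
        cupProduct hij (complexBetti.map (fst C A) i (T z₀)) (complexBetti.map (snd C A) j (S x₀)) := by
    rw [hR, LinearMap.comp_apply, LinearMap.comp_apply, LinearMap.comp_apply]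
    have e1 : (complexBetti.map φ.hom (a₂ + a₁)).hom (complexBetti.map φ.inv (a₂ + a₁) y₀) = y₀ := by
      change complexBetti.map φ.hom _ (complexBetti.map φ.inv _ y₀) = y₀
      rw [← complexBetti.map_comp_apply', Iso.hom_inv_id, complexBetti.map_id]
      rfl
    rw [e1, hy₀, hW₂v x₀ z₀]
    change W₁ (complexBetti.map (β_ C (X.pow e₂)).hom (a₂ + i) _) = _
    rw [map_braiding_hom_cross (rfl : a₂ + i = a₂ + i) (show i + a₂ = a₂ + i by omega) (T z₀) x₀, map_smul,
      hW₁v]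
  refine Submodule.subset_span ⟨e₂ + e₁, a₂ + a₁, R, hRalg,
    ((-1 : ℂ) ^ (a₂ * i)) • complexBetti.map φ.inv (a₂ + a₁) y₀, ?_⟩
  rw [map_smul, hRy, smul_smul, ← pow_add, ← two_mul, pow_mul, neg_one_sq, one_pow, one_smul]

/-- **The powers of a dominated variety are dominated**: `Y` dominated by the powers of `X` ⟹ so is every
`Y^{m+1} = Yᵐ ⊗ Y` (induction with `isDominatedByPowers_tensor`, starting from the point `Y⁰`).
[cite: Arapura2006, §1 Lemma 1.1 and §4 Lemma 4.2] -/
theorem isDominatedByPowers_pow_succ (hX : IsSmoothProjective dX X) {dY : ℕ} {Y : SchemeOver ℂ}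
    (hY : IsSmoothProjective dY Y) (hdom : IsDominatedByPowers dY Y dX X) :
    ∀ m : ℕ, IsDominatedByPowers ((m + 1) * dY) (Y.pow (m + 1)) dX X
  | 0 => by
    have h := isDominatedByPowers_tensor hX (isSmoothProjective_unit_holds ℂ) hY
      (isDominatedByPowers_unit hX) hdom
    rw [Nat.zero_add] at h
    rw [Nat.zero_add, Nat.one_mul]
    exact h
  | m + 1 => by
    have h := isDominatedByPowers_tensor hX (hY.pow (m + 1)) hY (isDominatedByPowers_pow_succ hX hY hdom m) hdom
    rw [show (m + 1 + 1) * dY = (m + 1) * dY + dY by ring]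
    exact h

/-- **Arapura 2006, Lemma 4.2 (HC clause; motivation in the algebraic form of Lemma 1.1) — the named fact
`HodgeTheory.Arapura2006_hodgeClasses_algebraic_of_isDominatedByPowers` PROVED**: for `X`, `Y` smooth
projective over `ℂ` with `Y` dominated by the powers of `X`, the Hodge conjecture for all `X^{m+1}` implies the
Hodge conjecture for `Y` (`hodgeConjectureFor_of_isDominatedByPowers`) and for every `Y^{m+1}` (the same theorem
for `Y^{m+1}`, dominated by `isDominatedByPowers_pow_succ`).  Users' `(h42 : Arapura2006_…)` are now fed this
theorem. [cite: Arapura2006, Lemma 4.2 and Lemma 1.1 (§4, §1)] [cite: Voisin2025, Cor. 2.12]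
[cite: Fulton1998, §16.1 Prop. 16.1.1] -/
theorem _root_.Literature.AlgebraicGeometry.HodgeTheory.Arapura2006_hodgeClasses_algebraic_of_isDominatedByPowers_holds :
    Arapura2006_hodgeClasses_algebraic_of_isDominatedByPowers :=
  fun _ _ _ _ hX hY hdom hpow ↦
    ⟨hodgeConjectureFor_of_isDominatedByPowers hX hY hdom hpow, fun m ↦
      hodgeConjectureFor_of_isDominatedByPowers hX (hY.pow (m + 1))
        (isDominatedByPowers_pow_succ hX hY hdom m) hpow⟩

end Products

end Part2

end Literature.AlgebraicGeometry.HodgeTheory.Arapura2006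

end
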